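import Summits.CriticalPhenomena.CardyFormulaZ2.Theorems.CardyBoundaryCoulombGasBoundaryDefectGaussianRStubTransportPathsPart16

/-!
# Stub `stub_transportPaths` of line `rainbow-monomials-in-excursion-kernels` — Part 18:
# rails: decomposition, the given insertion points lie on rails, feet and separation
# (crux `CardyBoundaryCoulombGas.BoundaryDefectGaussianR`, stmt-CriticalPhenomena-14132)

Bookkeeping on the rails `⟨v, dir (K+1)⟩ = Y` of the lattice approximation (Part 16):

* `tp_decomp` — `v = ⟨v, dir K⟩ • dir K + ⟨v, dir (K+1)⟩ • dir (K+1)`;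
* `tp_nb_cases` — the lattice neighbours of `u` are the `u + dir k`;
* `tp_on_rail` — a vertex of `V` with exactly one outside neighbour inside a flat lattice chart
  (threshold `Y`) lies ON the rail: `⟨u, dir (K+1)⟩ = Y` (otherwise all four neighbours are in
  `V`). This places the given admissible insertion points `p n i` of TRANSPORT on the rails of
  their marks' edges;
* `tp_rail_foot` — the foot `q = P + (δ x - A) i^e` of the rail point of along-coordinate `x` is
  within `δ` of its mesh point and is the boundary point `γ t₀` at distance `δ x - A` from the
  corner `P = γ (c z)` along the edge;
* `tp_sep_of_dist`, `tp_sep_same_rail` — the separation clause `(r/δ)² ≤ |u - u'|²` of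
  TRANSPORT from a distance `≥ r + 2δ` between feet, resp. from `|x - x'| ≥ r/δ` on one rail.
All [folklore].
-/

noncomputable section

open Set Filter Metric Topology
open Literature.Probability.RandomPlanarGeometry
open Literature.Probability.LatticeModels Literature.Probability.LatticeModels.CollarLegModel
open Summit.CriticalPhenomena.CardyFormulaZ2.Cruxes.RectilinearCardy.ExcursionKernelCovariance

namespace Summit.CriticalPhenomena.CardyFormulaZ2.Cruxes.BoundaryDefectGaussianR.RainbowMonomialsInExcursionKernels

/-! ### Lattice bookkeeping -/

/-- **Decomposition in a frame**: `v = ⟨v, dir K⟩ • dir K + ⟨v, dir (K+1)⟩ • dir (K+1)`.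
[folklore] -/
theorem tp_decomp (K : Fin 4) (v : ℤ × ℤ) :
    v = (v.1 * (dir K).1 + v.2 * (dir K).2) • dir K +
      (v.1 * (dir (K + 1)).1 + v.2 * (dir (K + 1)).2) • dir (K + 1) := by
  obtain ⟨x, y⟩ := v
  fin_cases K <;> simp [tp_dir_val]

/-- The lattice neighbours of `u` are the points `u + dir k`. [folklore] -/
theorem tp_nb_cases (u w : ℤ × ℤ) (hw : w ∈ neighbours u) : ∃ k : Fin 4, w = u + dir k := by
  obtain ⟨x, y⟩ := u
  simp only [neighbours, Finset.mem_insert, Finset.mem_singleton] at hw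
  rcases hw with rfl | rfl | rfl | rfl
  · exact ⟨0, by simp [tp_dir_val]⟩
  · exact ⟨1, by simp [tp_dir_val]⟩
  · exact ⟨2, by simp [tp_dir_val, Prod.ext_iff]; ring⟩
  · exact ⟨3, by simp [tp_dir_val, Prod.ext_iff]; ring⟩

/-- Every direction is one of `K, K+1, K+2, K+3`, in frame coordinates
`(1,0), (0,1), (-1,0), (0,-1)`. [folklore] -/
theorem tp_dir_frame (K k : Fin 4) : ∃ s t : ℤ, dir k = s • dir K + t • dir (K + 1) ∧
    -1 ≤ s ∧ s ≤ 1 ∧ -1 ≤ t ∧ t ≤ 1 := by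
  have h : ∀ K k : Fin 4, k = K ∨ k = K + 1 ∨ k = K + 2 ∨ k = K + 3 := by decide
  rcases h K k with rfl | rfl | rfl | rfl
  · exact ⟨1, 0, by simp, by norm_num, by norm_num, by norm_num, by norm_num⟩
  · exact ⟨0, 1, by simp, by norm_num, by norm_num, by norm_num, by norm_num⟩
  · exact ⟨-1, 0, by rw [tp_dir_add_two]; simp, by norm_num, by norm_num, by norm_num, by norm_num⟩
  · exact ⟨0, -1, by rw [tp_dir_add_three]; simp, by norm_num, by norm_num, by norm_num,
      by norm_num⟩

/-- **A vertex with exactly one outside neighbour inside a flat lattice chart lies on the rail.**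
If within lattice distance `2` of `u` (frame coordinates `|s|, |t| ≤ 2`) membership in `V` is
the threshold rule `Y ≤ ⟨·, dir (K+1)⟩`, `u ∈ V`, and `u` has exactly one lattice neighbour
outside `V`, then `⟨u, dir (K+1)⟩ = Y`. [folklore] -/
theorem tp_on_rail (V : Finset (ℤ × ℤ)) (K : Fin 4) (u : ℤ × ℤ) (Y : ℤ)
    (hmem : ∀ s t : ℤ, -2 ≤ s → s ≤ 2 → -2 ≤ t → t ≤ 2 →
      (u + s • dir K + t • dir (K + 1) ∈ V ↔
        Y ≤ (u + s • dir K + t • dir (K + 1)).1 * (dir (K + 1)).1 +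
          (u + s • dir K + t • dir (K + 1)).2 * (dir (K + 1)).2))
    (huV : u ∈ V) (hcard : ((neighbours u).filter (fun y => y ∉ V)).card = 1) :
    u.1 * (dir (K + 1)).1 + u.2 * (dir (K + 1)).2 = Y := by
  have h0 := (hmem 0 0 (by norm_num) (by norm_num) (by norm_num) (by norm_num)).1 (by simpa using huV)
  simp only [zero_smul, add_zero] at h0
  by_contra hne
  have hgt : Y + 1 ≤ u.1 * (dir (K + 1)).1 + u.2 * (dir (K + 1)).2 := by omega
  -- then all four neighbours are in `V`
  have hall : ∀ w ∈ neighbours u, w ∈ V := by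
    intro w hw
    obtain ⟨k, rfl⟩ := tp_nb_cases u w hw
    obtain ⟨s, t, hk, hs1, hs2, ht1, ht2⟩ := tp_dir_frame K k
    have e : u + dir k = u + s • dir K + t • dir (K + 1) := by rw [hk]; abel
    rw [e]
    refine (hmem s t (by omega) (by omega) (by omega) (by omega)).2 ?_
    rw [(tp_dot_lin K u s t).2.1]
    omega
  have : ((neighbours u).filter (fun y => y ∉ V)).card = 0 := by
    rw [Finset.card_eq_zero, Finset.filter_eq_empty_iff]
    intro w hw h
    exact h (hall w hw)
  omega

/-! ### Feet of rail points -/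

/-- **The foot of a rail point.** For the edge `z` (`P = γ (c z)`, frame exponent `e = a z`,
`A = re (P (-i)^e)`, `B = im (P (-i)^e)`) and an along-coordinate `x` with
`0 ≤ δ x - A ≤ ‖γ (c (z+1)) - P‖`, the foot `q = P + (δ x - A) i^e` is within `δ` of the mesh
point of the rail point `x • dir K + ⌈B/δ⌉ • dir (K+1)` and is a boundary point `γ t₀`,
`t₀ ∈ [c z, c (z+1)]`, at distance `δ x - A` from `P` and `‖γ (c (z+1)) - P‖ - (δ x - A)` from
the far corner. [folklore] -/
theorem tp_rail_foot (D : JordanDomain) {c : ℤ → ℝ} {a : ℤ → ℕ} (hcmono : StrictMono c)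
    (ha4 : ∀ z, a z < 4)
    (hdir : ∀ z, ∀ t ∈ Icc (c z) (c (z + 1)), D.boundary t =
      D.boundary (c z) + ((‖D.boundary t - D.boundary (c z)‖ : ℝ) : ℂ) * Complex.I ^ (a z))
    {δ : ℝ} (hδ : 0 < δ) (z x : ℤ)
    (h1 : 0 ≤ δ * x - (D.boundary (c z) * (-Complex.I) ^ (a z)).re)
    (h2 : δ * x - (D.boundary (c z) * (-Complex.I) ^ (a z)).re ≤
      ‖D.boundary (c (z + 1)) - D.boundary (c z)‖) :
    dist ((((x • dir (Fin.ofNat 4 (a z)) +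
        ⌈(D.boundary (c z) * (-Complex.I) ^ (a z)).im / δ⌉ • dir (Fin.ofNat 4 (a z) + 1)).1 : ℤ) : ℂ) *
          ((δ : ℝ) : ℂ) +
        (((x • dir (Fin.ofNat 4 (a z)) +
        ⌈(D.boundary (c z) * (-Complex.I) ^ (a z)).im / δ⌉ • dir (Fin.ofNat 4 (a z) + 1)).2 : ℤ) : ℂ) *
          ((δ : ℝ) : ℂ) * Complex.I)
      (D.boundary (c z) + ((δ * x - (D.boundary (c z) * (-Complex.I) ^ (a z)).re : ℝ) : ℂ) *
        Complex.I ^ (a z)) < δ ∧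
    ∃ t₀ ∈ Icc (c z) (c (z + 1)), D.boundary t₀ = D.boundary (c z) +
        ((δ * x - (D.boundary (c z) * (-Complex.I) ^ (a z)).re : ℝ) : ℂ) * Complex.I ^ (a z) ∧
      ‖D.boundary t₀ - D.boundary (c z)‖ = δ * x - (D.boundary (c z) * (-Complex.I) ^ (a z)).re ∧
      ‖D.boundary (c (z + 1)) - D.boundary t₀‖ =
        ‖D.boundary (c (z + 1)) - D.boundary (c z)‖ -
          (δ * x - (D.boundary (c z) * (-Complex.I) ^ (a z)).re) := by
  set γ := D.boundary with hγ
  have hγc : Continuous γ := D.continuous_boundary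
  set e := a z with he
  set K : Fin 4 := Fin.ofNat 4 e with hK
  have hKe : (K : ℕ) = e := tp_natCast_fin4 (ha4 z)
  set P := γ (c z) with hP
  set A := (P * (-Complex.I) ^ e).re with hA
  set B := (P * (-Complex.I) ^ e).im with hB
  set Y := ⌈B / δ⌉ with hY
  set Rpt : ℤ × ℤ := x • dir K + Y • dir (K + 1) with hRpt
  set ℓ := ‖γ (c (z + 1)) - P‖ with hℓ
  set s := δ * x - A with hs
  set q := P + (s : ℂ) * Complex.I ^ e with hq
  refine ⟨?_, ?_⟩
  · have hqframe : q * (-Complex.I) ^ e = P * (-Complex.I) ^ e + (s : ℂ) := by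
      rw [hq, add_mul, mul_assoc, I_pow_mul_neg_I_pow, mul_one]
    have hqim : (q * (-Complex.I) ^ e).im = B := by
      rw [hqframe, Complex.add_im, Complex.ofReal_im, add_zero]
    have hqre : (q * (-Complex.I) ^ e).re = δ * x := by
      rw [hqframe, Complex.add_re, Complex.ofReal_re, ← hA, hs]; ring
    have hRc := tp_rail_coords K x Y
    have hfr' := tp_mesh_frame K δ Rpt
    rw [hRc.1, hRc.2] at hfr'
    have hdiff : ((Rpt.1 : ℂ) * ((δ : ℝ) : ℂ) + (Rpt.2 : ℂ) * ((δ : ℝ) : ℂ) * Complex.I - q) *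
        (-Complex.I) ^ (K : ℕ) = (((δ * Y - B : ℝ) : ℂ)) * Complex.I := by
      refine Complex.ext ?_ ?_
      · rw [sub_mul, Complex.sub_re, hfr'.1, hKe, hqre]; simp
      · rw [sub_mul, Complex.sub_im, hfr'.2, hKe, hqim]; simp
    have hn : ‖((Rpt.1 : ℂ) * ((δ : ℝ) : ℂ) + (Rpt.2 : ℂ) * ((δ : ℝ) : ℂ) * Complex.I - q) *
        (-Complex.I) ^ (K : ℕ)‖ = |δ * Y - B| := by
      rw [hdiff, norm_mul, Complex.norm_I, mul_one, Complex.norm_real, Real.norm_eq_abs]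
    rw [norm_mul, norm_pow, norm_neg, Complex.norm_I, one_pow, mul_one] at hn
    rw [dist_eq_norm, hn]
    have hY1 : (Y : ℝ) < B / δ + 1 := Int.ceil_lt_add_one _
    have hY2 : B / δ ≤ Y := Int.le_ceil _
    rw [abs_of_nonneg (by rw [sub_nonneg, ← div_le_iff₀' hδ]; exact hY2)]
    have := (lt_div_iff₀' hδ).1 (by linarith : (Y : ℝ) - 1 < B / δ)
    linarith
  · have hcz : c z ≤ c (z + 1) := (hcmono (by omega : z < z + 1)).le
    have hs0 : 0 ≤ s := h1
    have hsℓ : s ≤ ℓ := h2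
    obtain ⟨t₀, ht₀, ht₀q⟩ := exists_mem_Icc_eq_of_norm_le' hγc hcz (hdir z) rfl hs0 hsℓ
    refine ⟨t₀, ht₀, ht₀q, ?_, ?_⟩
    · rw [ht₀q, add_sub_cancel_left, norm_mul, norm_pow, Complex.norm_I, one_pow, mul_one,
        Complex.norm_real, Real.norm_eq_abs, abs_of_nonneg hs0]
    · have hend : γ (c (z + 1)) = P + ((ℓ : ℝ) : ℂ) * Complex.I ^ e :=
        hdir z (c (z + 1)) ⟨hcz, le_rfl⟩
      rw [ht₀q, hend, show P + ((ℓ : ℝ) : ℂ) * Complex.I ^ e - (P + (s : ℂ) * Complex.I ^ e) =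
        ((ℓ - s : ℝ) : ℂ) * Complex.I ^ e by push_cast; ring, norm_mul, norm_pow, Complex.norm_I,
        one_pow, mul_one, Complex.norm_real, Real.norm_eq_abs, abs_of_nonneg (by linarith)]

/-! ### Separation -/

/-- **Separation from the distance of feet.** If the mesh points of `u`, `u'` are within `δ` of
points `q`, `q'` at distance `≥ r + 2δ`, then `(r/δ)² ≤ |u - u'|²`. [folklore] -/
theorem tp_sep_of_dist {δ r : ℝ} (hδ : 0 < δ) (hr : 0 ≤ r) (u u' : ℤ × ℤ) (q q' : ℂ)
    (hu : dist ((u.1 : ℂ) * ((δ : ℝ) : ℂ) + (u.2 : ℂ) * ((δ : ℝ) : ℂ) * Complex.I) q < δ)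
    (hu' : dist ((u'.1 : ℂ) * ((δ : ℝ) : ℂ) + (u'.2 : ℂ) * ((δ : ℝ) : ℂ) * Complex.I) q' < δ)
    (hqq' : r + 2 * δ ≤ dist q q') :
    (r / δ) ^ 2 ≤ (((u.1 - u'.1) ^ 2 + (u.2 - u'.2) ^ 2 : ℤ) : ℝ) := by
  have hsq := tp_mesh_dist_sq δ u u'
  have hd : r ≤ dist ((u.1 : ℂ) * ((δ : ℝ) : ℂ) + (u.2 : ℂ) * ((δ : ℝ) : ℂ) * Complex.I)
      ((u'.1 : ℂ) * ((δ : ℝ) : ℂ) + (u'.2 : ℂ) * ((δ : ℝ) : ℂ) * Complex.I) := by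
    have h1 := dist_triangle q ((u.1 : ℂ) * ((δ : ℝ) : ℂ) + (u.2 : ℂ) * ((δ : ℝ) : ℂ) * Complex.I) q'
    have h2 := dist_triangle ((u.1 : ℂ) * ((δ : ℝ) : ℂ) + (u.2 : ℂ) * ((δ : ℝ) : ℂ) * Complex.I)
      ((u'.1 : ℂ) * ((δ : ℝ) : ℂ) + (u'.2 : ℂ) * ((δ : ℝ) : ℂ) * Complex.I) q'
    rw [dist_comm] at hu
    linarith
  have hd2 : r ^ 2 ≤ δ ^ 2 * (((u.1 - u'.1) ^ 2 + (u.2 - u'.2) ^ 2 : ℤ) : ℝ) := by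
    rw [← hsq]; exact pow_le_pow_left₀ hr hd 2
  rw [div_pow, div_le_iff₀ (by positivity)]
  linarith

/-- **Separation on one rail**: `|x - x'| ≥ r/δ` gives `(r/δ)² ≤ |R x - R x'|²` for the rail
points `R x = x • dir K + Y • dir (K+1)`. [folklore] -/
theorem tp_sep_same_rail {δ r : ℝ} (hδ : 0 < δ) (hr : 0 ≤ r) (K : Fin 4) (Y x x' : ℤ)
    (h : r / δ ≤ |((x - x' : ℤ) : ℝ)|) :
    (r / δ) ^ 2 ≤ ((((x • dir K + Y • dir (K + 1)).1 - (x' • dir K + Y • dir (K + 1)).1) ^ 2 +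
      ((x • dir K + Y • dir (K + 1)).2 - (x' • dir K + Y • dir (K + 1)).2) ^ 2 : ℤ) : ℝ) := by
  have hx : x • dir K + Y • dir (K + 1) = x' • dir K + Y • dir (K + 1) + (x - x') • dir K +
      (0 : ℤ) • dir (K + 1) := by module
  have key := (tp_dot_lin K (x' • dir K + Y • dir (K + 1)) (x - x') 0).2.2
  rw [← hx] at key
  rw [key]
  have h0 : 0 ≤ r / δ := div_nonneg hr hδ.le
  have := pow_le_pow_left₀ h0 h 2
  rw [sq_abs] at this
  push_cast at this ⊢
  linarith

/-- **Registered sub-goal `s7_onRail` of stub `stub_transportPaths`** (an insertion point with one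
outside neighbour in a flat lattice chart lies on the rail, one-line form of `tp_on_rail`).
[folklore] -/
theorem s7_onRail : ∀ (V : Finset (ℤ × ℤ)) (K : Fin 4) (u : ℤ × ℤ) (Y : ℤ), (∀ s t : ℤ, -2 ≤ s → s ≤ 2 → -2 ≤ t → t ≤ 2 → (u + s • dir K + t • Literature.Probability.LatticeModels.CollarLegModel.dir (K + 1) ∈ V ↔ Y ≤ (u + s • dir K + t • Literature.Probability.LatticeModels.CollarLegModel.dir (K + 1)).1 * (Literature.Probability.LatticeModels.CollarLegModel.dir (K + 1)).1 + (u + s • dir K + t • Literature.Probability.LatticeModels.CollarLegModel.dir (K + 1)).2 * (Literature.Probability.LatticeModels.CollarLegModel.dir (K + 1)).2)) → (u ∈ V) → (((Literature.Probability.LatticeModels.CollarLegModel.neighbours u).filter (fun y => y ∉ V)).card = 1) → u.1 * (Literature.Probability.LatticeModels.CollarLegModel.dir (K + 1)).1 + u.2 * (Literature.Probability.LatticeModels.CollarLegModel.dir (K + 1)).2 = Y :=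
  fun V K u Y hmem huV hcard => tp_on_rail V K u Y hmem huV hcard

end Summit.CriticalPhenomena.CardyFormulaZ2.Cruxes.BoundaryDefectGaussianR.RainbowMonomialsInExcursionKernels

end
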